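import Summits.ResolutionOfSingularities.ResolutionOfSingularities.Theorems.PurelyInseparableDim4ResConeCInfPinningPrime
import HarnessLib
import HarnessLib.Audit.Tags

/-!
# Purely inseparable four-folds — PINNING OF THE FORM-CARRYING LETTER FOR EVERY WEIGHT VECTOR σ ((VT-f) ∀ σ): in a power-cone
# state straight at `f` with ANY boundary monomial `x^r` (`r_f = 0`) of order `|r| + d`, a step in a boundary chart `κ` whose
# translation lives on `f` alone and whose child has order `> |r|` does not translate `f` (cell `res-dim4-pi`, K2(p) lane, B-LF
# (iii-b) K24a-PRIME-σ, transport layer; the light pair `r = e_λ + e_μ` is W2 `…ResConeCInfPinningPrime` p713198)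

[OURS · counted 0 · cell `res-dim4-pi` · K2(p) lane (holder res-dim4-p-12 g5, ruling g5-17: «K24a-PRIME-σ = three layers — step/α
res-dim4-p-1 g6 · β-readings res-dim4-p-7 g6 · window transport res-dim4-typ-1 g5»).]  Nothing here proves K2(p) for any `p`, any
TAIL(p, d, 3), `NoIsolatedTrap p p` or resolution of singularities in dimension ≥ 4 / characteristic `p` — NOT proved.  AI kernel
work, weaker than expert review.  A state-level reading lemma for OUR frame; kills nothing by itself.

WHY THIS IS THE WHOLE TRANSPORT LAYER WHEN A PASSIVE LETTER IS WEIGHTED (class (i) of the seat's scoping text, bus 2026-08-29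
12:28Z): with slots `λ, μ` of weight `n`, a passive letter of weight `W ≥ 1` and the form carrier `f` free (T-branch of res-dim4-p-1 g6's
`powerCone_TL_dichotomy`), `f` is never charted (`chart_ne_contact_of_straight`) and every other letter is weighted, so a step that
keeps σ is `step p univ κ b` with `κ ∈ {λ, μ}` and `b` supported on `f` — and then `b = 0` by this file: the REAL σ-tail is pure-corner
in the once-straightened frame, no virtual window is needed.  (The class `W = 0` — two free letters — is the C∞ window W1–W6a.)

* §1 `shear_monomial_contact_pow` — Hauser's shear of the straight initial monomial: `shear_κ^b (a·x^r·x_f^d) = a·x^r·(x_f + b_f x_κ)^d`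
  when `b` vanishes off `f`;  `coeff_monomial_mul_contact_shear_pow` — its coefficient at `x^r·x_κ^d` is `a·b_f^d`.
* §2 **`coeff_step_at_weights_sigma`** — for a state of order `|r| + d = p + n` with `in F = a·x^r x_f^d` (`r_f = 0`, `0 < r_κ = n < p`), the
  `Step p` in the chart `κ` with translation `b` supported on `f` has `coeff_r F′ = a · b_f^d` (chart law at `x^r x_κ^d`, which has
  degree `p + n = ord`, so only the initial form is read; `x^r` is no `p`-th power since `0 < r_κ < p`).
* §3 **`translation_contact_eq_zero_sigma`** — if moreover `a ≠ 0`, `1 ≤ d` and the child has order `> |r|`, then `b_f = 0`.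
Dictionary: `|r| + d = ord` is `n + W + d = p` read as `2n + W + d = p + n`; the light pair is `r = e_λ + e_μ`, `d + 2 = p + 1`.
[cite: Hauser2010, §§F, I] [cite: CossartJannsenSaito2020, Thm. 3.14]
bears_on: LADDER-RESOLUTION:D157-DOOR2 (res-dim4-pi · K2(p) · power cones · (VT-f) ∀ σ).  Supports
stmt-ResolutionOfSingularities-16155 (helper).
-/

set_option linter.dupNamespace false -- mandated namespace of this single-conjunct summit

namespace Summit.ResolutionOfSingularities.ResolutionOfSingularities.Theorems.PIDim4

namespace ResCone

open MvPolynomial Finset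
open Literature.AlgebraicGeometry.Resolution
open Literature.AlgebraicGeometry.Resolution.CentreBlowup
open Literature.AlgebraicGeometry.Resolution.Hauser2010
open Literature.AlgebraicGeometry.Resolution.HauserPerlega2019

variable {K : Type} [Field K] [DecidableEq K]

/-! ## 1. The shear of the straight initial monomial, any boundary monomial -/

omit [DecidableEq K] in
/-- Hauser's shear of the straight initial monomial with an arbitrary boundary monomial: `shear_κ^b (a·x^r·x_f^d) = a·x^r·(x_f + b_f x_κ)^d`
when `r_f = 0` and `b` vanishes off `f`. [cite: Hauser2010, §I (definition of P⁺)] -/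
theorem shear_monomial_contact_pow {κ f : Fin 4} (hκf : κ ≠ f) {r : Fin 4 →₀ ℕ} (hrf : r f = 0) {b : Fin 4 → K}
    (hb : ∀ i, i ≠ f → b i = 0) (a : K) (d : ℕ) :
    shear κ b (monomial (r + Finsupp.single f d) a) = monomial r a * (X f + C (b f) * X κ) ^ d := by
  classical
  -- the shear fixes `x^r` (no `x_f` in it, and `b` vanishes on the letters of `r`)
  have hr : aeval (fun i => if i = κ then X κ else X i + C (b i) * X κ) (monomial r (1 : K)) = monomial r 1 := by
    rw [aeval_monomial, algebraMap_eq, monomial_eq]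
    congr 1
    rw [Finsupp.prod, Finsupp.prod]
    refine Finset.prod_congr rfl fun i hi => ?_
    by_cases hiκ : i = κ
    · rw [hiκ, if_pos rfl]
    · have hif : i ≠ f := fun h => (Finsupp.mem_support_iff.mp hi) (by rw [h]; exact hrf)
      rw [if_neg hiκ, hb i hif, C_0, zero_mul, add_zero]
  have hsplit : (monomial (r + Finsupp.single f d) a : MvPolynomial (Fin 4) K) = C a * monomial r 1 * X f ^ d := by
    rw [X_pow_eq_monomial, C_mul_monomial, mul_one, monomial_mul, mul_one]
  rw [hsplit]
  unfold shear
  rw [map_mul, map_mul, map_pow, aeval_C, algebraMap_eq, aeval_X, if_neg hκf.symm, hr, C_mul_monomial, mul_one]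

omit [DecidableEq K] in
/-- The coefficient of `a·x^r·(x_f + γ x_κ)^d` at `x^r·x_κ^d` is `a γ^d` (`(x_f + γx_κ)^d ≡ γ^d x_κ^d (mod x_f)`, `r_f = 0`). [folklore] -/
theorem coeff_monomial_mul_contact_shear_pow {κ f : Fin 4} (hκf : κ ≠ f) {r : Fin 4 →₀ ℕ} (hrf : r f = 0) (a γ : K) (d : ℕ) :
    coeff (r + Finsupp.single κ d) (monomial r a * (X f + C γ * X κ) ^ d : MvPolynomial (Fin 4) K) = a * γ ^ d := by
  classical
  obtain ⟨R, hR⟩ := sub_dvd_pow_sub_pow (X f + C γ * X κ : MvPolynomial (Fin 4) K) (C γ * X κ) d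
  rw [add_sub_cancel_right] at hR
  have h4 : ((X f + C γ * X κ) ^ d : MvPolynomial (Fin 4) K) = monomial (Finsupp.single κ d) (γ ^ d) + X f * R := by
    rw [← hR, mul_pow, ← C_pow, X_pow_eq_monomial, C_mul_monomial, mul_one]; ring
  rw [h4, mul_add, coeff_add, monomial_mul, coeff_monomial, if_pos rfl, ← mul_assoc, mul_comm (monomial r a) (X f), mul_assoc,
    coeff_X_mul', if_neg, add_zero]
  rw [Finsupp.mem_support_iff, not_not, Finsupp.add_apply, hrf, Finsupp.single_eq_of_ne hκf.symm, add_zero]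

/-! ## 2. The reading at `x^r` of the child, every weight vector -/

/-- **The reading at `x^r` of the child, every σ.**  For a state of order `|r| + d` with straight contact initial form `in F = a·x^r·x_f^d`
(`r_f = 0`, `0 < r_κ = n < p`, `|r| + d = p + n`), the `Step p` in the boundary chart `κ` with a translation supported on `f` has
`coeff_{x^r} F′ = a · b_f^d`.
[OURS] [cite: Hauser2010, §§F, I] -/
theorem coeff_step_at_weights_sigma (p : ℕ) {d n : ℕ} (hn : 0 < n) (hnp : n < p) {r : Fin 4 →₀ ℕ} {κ f : Fin 4}
    (hκf : κ ≠ f) (hrf : r f = 0) (hrκ : r κ = n) (hord : r.degree + d = p + n) {s : State K}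
    (ho : ordZero s.F = ((p + n : ℕ) : ℕ∞)) {a : K} (hin : initialForm s.F = monomial (r + Finsupp.single f d) a)
    {b : Fin 4 → K} (hb : ∀ i, i ≠ f → b i = 0) :
    coeff r (CentreBlowup.step p Finset.univ κ b s).F = a * b f ^ d := by
  have hbκ : b κ = 0 := hb κ hκf
  have hq : ((p : ℕ) : ℕ∞) ≤ ordAlong Finset.univ s.F := by
    rw [ordAlong_univ, ho]; exact_mod_cast Nat.le_add_right p n
  -- the chart preimage of `x^r` is `x^r x_κ^d`, of degree `|r| + d = p + n`
  have hdeg : (r + Finsupp.single κ d : Fin 4 →₀ ℕ).degree = p + n := by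
    rw [map_add, Finsupp.degree_single, hord]
  have hce : chartExponent p Finset.univ κ (r + Finsupp.single κ d) = r := by
    apply Finsupp.ext
    intro i
    by_cases hi : i = κ
    · subst hi
      rw [chartExponent, degIn_univ, hdeg, Finsupp.coe_update, Function.update_self]
      omega
    · rw [chartExponent_apply_of_ne p Finset.univ hi, Finsupp.add_apply, Finsupp.single_eq_of_ne hi, add_zero]
  have hnp' : ¬ IsPthPowerExponent p (chartExponent p Finset.univ κ (r + Finsupp.single κ d)) := by
    rw [hce]
    refine not_isPthPowerExponent_of_not_dvd (i := κ) ?_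
    rw [hrκ]
    exact Nat.not_dvd_of_pos_of_lt hn hnp
  have h := coeff_step_F_chartExponent p κ hbκ s hq (e := r + Finsupp.single κ d) (by rw [hdeg]; omega)
  rw [if_neg hnp', hce, coeff_shear_eq_coeff_shear_initialForm_of_degree_eq κ b ho hdeg, hin,
    shear_monomial_contact_pow hκf hrf hb, coeff_monomial_mul_contact_shear_pow hκf hrf] at h
  exact h

/-! ## 3. Pinning of the form-carrying letter, every weight vector -/

/-- **(VT-f) FOR EVERY WEIGHT VECTOR σ**: in the setting of `coeff_step_at_weights_sigma` with `a ≠ 0` and `1 ≤ d`, if the child has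
order `> |r|` (in a σ-tail: order `p + n` again) then the form-carrying letter was NOT translated: `b_f = 0` (otherwise the child
contains `a b_f^d · x^r`, of degree `|r|`). [OURS] [cite: CossartJannsenSaito2020, Thm. 3.14] -/
theorem translation_contact_eq_zero_sigma (p : ℕ) {d n : ℕ} (hd1 : 1 ≤ d) (hn : 0 < n) (hnp : n < p) {r : Fin 4 →₀ ℕ}
    {κ f : Fin 4} (hκf : κ ≠ f) (hrf : r f = 0) (hrκ : r κ = n) (hord : r.degree + d = p + n) {s : State K}
    (ho : ordZero s.F = ((p + n : ℕ) : ℕ∞)) {a : K} (ha : a ≠ 0)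
    (hin : initialForm s.F = monomial (r + Finsupp.single f d) a) {b : Fin 4 → K} (hb : ∀ i, i ≠ f → b i = 0)
    (ho' : ((r.degree + 1 : ℕ) : ℕ∞) ≤ ordZero (CentreBlowup.step p Finset.univ κ b s).F) : b f = 0 := by
  have h := coeff_step_at_weights_sigma p hn hnp hκf hrf hrκ hord ho hin hb
  have h0 : coeff r (CentreBlowup.step p Finset.univ κ b s).F = 0 := by
    apply coeff_eq_zero_of_degree_lt_ordZero
    refine lt_of_lt_of_le ?_ ho'
    exact_mod_cast Nat.lt_succ_self _
  rw [h0] at h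
  have hpow : b f ^ d = 0 := by
    rcases mul_eq_zero.mp h.symm with h1 | h1
    · exact absurd h1 ha
    · exact h1
  exact pow_eq_zero_iff (by omega) |>.mp hpow

/-- The σ-tail form of `translation_contact_eq_zero_sigma`: the child has order `p + n` again. [OURS] -/
theorem translation_contact_eq_zero_sigma_of_eq (p : ℕ) {d n : ℕ} (hd1 : 1 ≤ d) (hn : 0 < n) (hnp : n < p)
    {r : Fin 4 →₀ ℕ} {κ f : Fin 4} (hκf : κ ≠ f) (hrf : r f = 0) (hrκ : r κ = n) (hord : r.degree + d = p + n)
    {s : State K} (ho : ordZero s.F = ((p + n : ℕ) : ℕ∞)) {a : K} (ha : a ≠ 0)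
    (hin : initialForm s.F = monomial (r + Finsupp.single f d) a) {b : Fin 4 → K} (hb : ∀ i, i ≠ f → b i = 0)
    (ho' : ordZero (CentreBlowup.step p Finset.univ κ b s).F = ((p + n : ℕ) : ℕ∞)) : b f = 0 := by
  refine translation_contact_eq_zero_sigma p hd1 hn hnp hκf hrf hrκ hord ho ha hin hb ?_
  rw [ho']
  exact_mod_cast (by omega : r.degree + 1 ≤ p + n)

end ResCone

end Summit.ResolutionOfSingularities.ResolutionOfSingularities.Theorems.PIDim4
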